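import Summits.ResolutionOfSingularities.ResolutionOfSingularities.Theorems.MarkedTransferCampaignW46TameRidge
import Literature.AlgebraicGeometry.Resolution.HasseSchmidtDiffEqDiffOp
import HarnessLib

/-!
# [OURS · L1 W4.6, rung (iv) «large characteristic»] The ridge of a hypersurface cone is its Hasse stabiliser
# (every characteristic, every commutative `K`-algebra), hence in tame degree the ridge IS the polar kernel as a
# functor of points — the group-scheme structure of the barrier disappears for `deg F < p`
# (cell res-hironaka, LADDER-RESOLUTION rung L, D-0089; slot W4.6, seat res-L1-s46-pv-7; host route MarkedTransfer,
# `--supports stmt-ResolutionOfSingularities-16155 --as helper`)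

HONEST FRAMING. Nothing here is a statement of H. Hironaka's manuscript (2017-03-23, [Hironaka2017]) and nothing here
asserts that any statement of it holds. Self-contained commutative algebra over the TREE's vocabulary (Giraud's ridge
functor `Resolution.ridge k' I`, its cone property `smul_mem_ridge'` and functoriality `map_mem_ridge`; the shift
`Literature.RingTheory.MvPolynomial.shift`; `WeightedBlowup.HasseDir.dirShift/hasseD`; the multi-index Hasse–Schmidt
derivatives `hasseDeriv` with `hasseDeriv_monomial`) and this seat's `TamePolar` (p481074) / `TameRidge` (p483259).
No premise of the manuscript, no FACT-LIST premise. AI review is weaker than expert review. No `sorry`, no definition;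
axioms standard.

## What is proved (and why it sharpens `TameRidge`)

`TameRidge` computed the `k'`-points of the ridge of a tame form over FIELDS `k' ⊇ K` (root counting in `T`). The
barrier phenomenon (`DirectrixSmallCharacteristic`: the ridge is a GROUP SCHEME, visibly non-reduced / bigger than the
directrix) lives in the functor of points on ALL `K`-algebras. Here:

* `isHomogeneous_hasseDeriv`, `isHomogeneous_hasseD` — Hasse derivatives of a form of degree `b` are forms of degree
  `b − |α|` (adapted from the tree's proof pattern; binomial formula `hasseDeriv_monomial`).
* `eq_zero_of_isHomogeneous_of_mem_span_singleton` — a form of degree `< b` that is a multiple of a form of degree `b`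
  is zero.
* `optionEquiv_map`, `optionEquiv_shift_map` — transport along Mathlib's `optionEquivRight.symm ≫ optionEquivLeft`
  (`k'[T][X] ≅ k'[X][T]`): the base change of `F` goes to the constant `F ⊗ 1`, its translate by `T · v` goes to the
  directional shift `F(X + Tv) = dirShift v F`.
* `mem_ridge_span_singleton_iff_forall_hasseD` — **THE RIDGE OF A FORM IS ITS HASSE STABILISER** (every
  characteristic; every commutative `K`-algebra `k'` in the universe of `K`): `v ∈ F(k')` iff `D_v^{(j)} F = 0` in
  `k'[X]` for all `j ≥ 1`, i.e. iff `F(X + Tv) = F(X)` formally. (⇒: the ridge is a functorial cone, so `T · v` is a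
  `k'[T]`-point; transport to `k'[X][T]` and compare `T`-coefficients: each `D_v^{(j)} F`, `j ≥ 1`, is a multiple of `F`
  of lower degree. ⇐: set `T = 1`.)
* `hasseD_eq_zero_of_polar_eq_zero_of_isUnit` — tame degrees over any commutative ring: `∂_v F = 0` and `1, …, deg F`
  units ⟹ all `D_v^{(j)} F = 0`.
* `mem_ridge_span_singleton_iff_polar_eq_zero` — **TAME RIDGE = POLAR KERNEL AS FUNCTORS**: for `F` homogeneous of
  degree `b` with `1, …, b` non-zero in `K` and EVERY commutative `K`-algebra `k'` (universe of `K`):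
  `v ∈ F(k') ⟺ Σ_i v_i ∂F/∂Y_i = 0` in `k'[X]`. So the ridge of a tame hypersurface cone is the functor of points of
  the `K`-linear subspace `ker(polar)` = Hironaka's `𝕎({F})` (`TamePolar`): a vector subspace defined over `K`, smooth
  and reduced — none of the purely inseparable group-scheme structure that the barrier exhibits at `deg F = p` (there,
  e.g. for `Y_0^p`, the `K[ε]/(ε^p)`-point `ε e_0` lies in the ridge: `mem_ridge_X_pow_char_of_pow_eq_zero`, while
  `e_0` does not, `TameRidge.single_notMem_ridge_X_pow`).

## References (context; nothing is cited as a premise)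

* J. Giraud, Ann. Sci. ÉNS 8 (1975) §1.5 [cite: Giraud1975, §1.5]; Berthomieu–Hivert–Mourtada 2010, Prop.–Def. 2.1
  and its proof (the ridge ideal generated by the `s_ℓ(f)`), Lemma 3.6 [cite: BerthomieuHivertMourtada2010, Prop. 2.1, Lemma 3.6];
  EGA IV₄ 16.11.2 (Hasse–Schmidt binomial formula) [cite: EGAIV4, Thm. 16.11.2]; barrier `DirectrixSmallCharacteristic`.
-/

noncomputable section

set_option linter.dupNamespace false -- mandated namespace of this single-conjunct summit

namespace Summit.ResolutionOfSingularities.ResolutionOfSingularities.Theorems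
namespace CampaignW46
namespace TameRidgeFunctor

open MvPolynomial
open Literature.RingTheory.MvPolynomial
open Literature.AlgebraicGeometry.Resolution
open Literature.AlgebraicGeometry.Resolution.WeightedBlowup.HasseDir

universe u v

/-! ## Hasse derivatives of forms are forms -/

section Homogeneous

variable {σ : Type*} {R : Type*} [CommRing R]

/-- A multi-index Hasse–Schmidt derivative of a form of degree `d` is a form of degree `d − |α|` (binomial formula on
monomials; proof pattern adapted from the tree's `S04CharAlgebra.Itm412R2Graded.isHomogeneous_hasseDeriv`, restated
here over an arbitrary index type to avoid importing a manuscript-row file). [folklore] -/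
theorem isHomogeneous_hasseDeriv [DecidableEq σ] {f : MvPolynomial σ R} {d : ℕ} (hf : f.IsHomogeneous d)
    (α : σ →₀ ℕ) : (hasseDeriv R α f).IsHomogeneous (d - α.degree) := by
  rw [f.as_sum, map_sum]
  refine IsHomogeneous.sum _ _ _ fun δ hδ => ?_
  by_cases hle : α ≤ δ
  · rw [hasseDeriv_monomial]
    have hdeg : (δ - α).degree = d - α.degree := by
      have h1 : (δ - α).degree + α.degree = δ.degree := by rw [← map_add, tsub_add_cancel_of_le hle]
      have h2 : δ.degree = d := by
        by_contra h
        exact (mem_support_iff.mp hδ) (hf.coeff_eq_zero h)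
      omega
    rw [← map_natCast C, C_mul_monomial]
    exact isHomogeneous_monomial _ hdeg
  · rw [hasseDeriv_monomial_eq_zero_of_not_le R hle]
    exact isHomogeneous_zero _ _ _

/-- A directional Hasse derivative of order `j` of a form of degree `d` is a form of degree `d − j`
(`hasseD_eq_sum_hasseDeriv`: `D_v^{(j)} = Σ_{|α| = j} v^α D^{(α)}`). [folklore] -/
theorem isHomogeneous_hasseD {H : MvPolynomial σ R} {d : ℕ} (hH : H.IsHomogeneous d) (v : σ → R) (j : ℕ) :
    (hasseD v j H).IsHomogeneous (d - j) := by
  classical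
  rw [hasseD_eq_sum_hasseDeriv]
  refine IsHomogeneous.sum _ _ _ fun α hα => ?_
  rw [Finset.mem_filter] at hα
  have h := (isHomogeneous_C σ (α.prod fun i e => v i ^ e)).mul (isHomogeneous_hasseDeriv hH α)
  rwa [hα.2, zero_add] at h

/-- **A form of lower degree that is a multiple of a form is zero**: if `G` is homogeneous of degree `b`, `H` is
homogeneous of degree `e < b` and `H ∈ (G)`, then `H = 0`. [folklore] -/
theorem eq_zero_of_isHomogeneous_of_mem_span_singleton {S : Type*} [CommSemiring S] {G H : MvPolynomial σ S}
    {b e : ℕ} (hG : G.IsHomogeneous b) (hH : H.IsHomogeneous e) (he : e < b)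
    (h : H ∈ Ideal.span ({G} : Set (MvPolynomial σ S))) : H = 0 := by
  obtain ⟨g, hg⟩ := Ideal.mem_span_singleton'.mp h
  ext m
  rw [coeff_zero]
  by_cases hm : m.degree = e
  · rw [← hg]
    exact TameRidge.coeff_mul_eq_zero_of_degree_lt hG g (by omega)
  · exact hH.coeff_eq_zero hm

end Homogeneous

/-! ## Tame degrees over any commutative ring: a vanishing polar kills all Hasse derivatives -/

section Units

variable {σ : Type*} [Fintype σ] {R : Type*} [CommRing R]

/-- If `Σ_i v_i ∂_i H = 0` and `1, …, deg H` are UNITS of `R`, then `D_v^{(j)} H = 0` for all `j ≥ 1`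
(`TamePolar.hasseD_polar`: `D^{(j)}(∂_v H) = (j+1) D^{(j+1)} H`). [folklore] -/
theorem hasseD_eq_zero_of_polar_eq_zero_of_isUnit (v : σ → R) {H : MvPolynomial σ R}
    (hunit : ∀ m : ℕ, 1 ≤ m → m ≤ H.totalDegree → IsUnit (m : R))
    (hpol : ∑ i, C (v i) * pderiv i H = 0) : ∀ j : ℕ, 1 ≤ j → hasseD v j H = 0 := by
  intro j hj
  rcases Nat.lt_or_ge H.totalDegree j with hlt | hle
  · exact hasseD_eq_zero_of_totalDegree_lt v H hlt
  · obtain ⟨j', rfl⟩ : ∃ j', j = j' + 1 := ⟨j - 1, by omega⟩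
    have h := TamePolar.hasseD_polar v j' H
    rw [hpol, hasseD_zero_right] at h
    have hu : IsUnit ((j' : MvPolynomial σ R) + 1) := by
      rw [← Nat.cast_succ, ← map_natCast (C : R →+* MvPolynomial σ R)]
      exact (hunit (j' + 1) (by omega) hle).map C
    exact (hu.mul_left_eq_zero).mp h.symm

end Units

/-! ## Transport `k'[T][X] ≅ k'[X][T]` -/

section Transport

variable {K : Type u} [Field K] {n : ℕ} {k' : Type v} [CommRing k'] [Algebra K k']

/-- The composite `optionEquivRight.symm ≫ optionEquivLeft : k'[T][X_1..X_n] ≅ k'[X][T]` on a variable `X_i`.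
[folklore] -/
theorem optionEquiv_X (i : Fin n) :
    ((optionEquivRight k' (Fin n)).symm.trans (optionEquivLeft k' (Fin n))) (X i : MvPolynomial (Fin n) (Polynomial k')) =
      Polynomial.C (X i) := by
  have h1 : (optionEquivRight k' (Fin n)).symm (X i : MvPolynomial (Fin n) (Polynomial k')) = X (some i) :=
    (AlgEquiv.symm_apply_eq _).mpr (optionEquivRight_X_some (R := k') (Fin n) i).symm
  rw [AlgEquiv.trans_apply, h1, optionEquivLeft_X_some]

/-- … on a constant `C (C a)`. [folklore] -/
theorem optionEquiv_C_C (a : k') :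
    ((optionEquivRight k' (Fin n)).symm.trans (optionEquivLeft k' (Fin n)))
        (C (Polynomial.C a) : MvPolynomial (Fin n) (Polynomial k')) = Polynomial.C (C a) := by
  have h1 : (optionEquivRight k' (Fin n)).symm (C (Polynomial.C a) : MvPolynomial (Fin n) (Polynomial k')) = C a :=
    (AlgEquiv.symm_apply_eq _).mpr (optionEquivRight_C k' (Fin n) a).symm
  rw [AlgEquiv.trans_apply, h1, optionEquivLeft_C]

/-- … on the constant `C T`. [folklore] -/
theorem optionEquiv_C_X :
    ((optionEquivRight k' (Fin n)).symm.trans (optionEquivLeft k' (Fin n)))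
        (C Polynomial.X : MvPolynomial (Fin n) (Polynomial k')) = Polynomial.X := by
  have h1 : (optionEquivRight k' (Fin n)).symm (C Polynomial.X : MvPolynomial (Fin n) (Polynomial k')) = X none :=
    (AlgEquiv.symm_apply_eq _).mpr (optionEquivRight_X_none k' (Fin n)).symm
  rw [AlgEquiv.trans_apply, h1, optionEquivLeft_X_none]

/-- Under `optionEquivRight.symm ≫ optionEquivLeft`, the base change `F ⊗ 1` of `F` to `k'[T]` is the constant
polynomial `C (F ⊗ 1)`. [folklore] -/
theorem optionEquiv_map (F : MvPolynomial (Fin n) K) :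
    ((optionEquivRight k' (Fin n)).symm.trans (optionEquivLeft k' (Fin n)))
        (MvPolynomial.map (algebraMap K (Polynomial k')) F) =
      Polynomial.C (MvPolynomial.map (algebraMap K k') F) := by
  induction F using MvPolynomial.induction_on with
  | C a => rw [map_C, map_C, Polynomial.algebraMap_apply, optionEquiv_C_C]
  | add p q hp hq => rw [map_add, map_add, hp, hq, map_add, map_add]
  | mul_X p i hp => rw [map_mul, map_X, map_mul, hp, optionEquiv_X, map_mul, map_X, ← map_mul]

/-- Under the same equivalence, the translate of `F ⊗ 1` by `T · v` is the directional shift `F(X + Tv)`.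
[folklore] -/
theorem optionEquiv_shift_map (F : MvPolynomial (Fin n) K) (v : Fin n → k') :
    ((optionEquivRight k' (Fin n)).symm.trans (optionEquivLeft k' (Fin n)))
        (shift ((Polynomial.X : Polynomial k') • fun j => Polynomial.C (v j))
          (MvPolynomial.map (algebraMap K (Polynomial k')) F)) =
      dirShift v (MvPolynomial.map (algebraMap K k') F) := by
  induction F using MvPolynomial.induction_on with
  | C a =>
    have h2 : shift ((Polynomial.X : Polynomial k') • fun j => Polynomial.C (v j))
        (C (Polynomial.C (algebraMap K k' a)) : MvPolynomial (Fin n) (Polynomial k')) =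
          C (Polynomial.C (algebraMap K k' a)) := by
      simp [shift]
    rw [map_C, map_C, Polynomial.algebraMap_apply, h2, optionEquiv_C_C, dirShift_C]
  | add p q hp hq => rw [map_add, map_add, map_add, hp, hq, map_add, map_add]
  | mul_X p i hp =>
    have h4 : shift ((Polynomial.X : Polynomial k') • fun j => Polynomial.C (v j))
        (X i : MvPolynomial (Fin n) (Polynomial k')) = X i + C Polynomial.X * C (Polynomial.C (v i)) := by
      rw [shift_X, Pi.smul_apply, smul_eq_mul, map_mul]
    rw [map_mul, map_X, map_mul, map_mul, hp, h4, map_add, optionEquiv_X, map_mul, optionEquiv_C_X, optionEquiv_C_C,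
      map_mul, map_X, map_mul, dirShift_X]
    ring

end Transport

/-! ## The ridge of a form is its Hasse stabiliser (every characteristic) -/

section Ridge

variable {K : Type u} [Field K] {n : ℕ}

/-- [OURS · L1 W4.6 (iv); NOT a statement of the manuscript] **Ridge ⟹ all Hasse derivatives vanish.** For a form `F`
of degree `b` over `K`, a commutative `K`-algebra `k'` (universe of `K`) and `v ∈ F(k')`: `D_v^{(j)}(F ⊗ 1) = 0` in
`k'[X]` for every `j ≥ 1`. Every characteristic. (The point `T · v` of `F(k'[T])` gives `F(X + Tv) ∈ (F) · k'[T][X]`;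
in `k'[X][T]` the `T^j`-coefficient `D_v^{(j)} F` is then a multiple of `F` of degree `b − j < b`.) [folklore] -/
theorem hasseD_eq_zero_of_mem_ridge {k' : Type u} [CommRing k'] [Algebra K k'] {F : MvPolynomial (Fin n) K} {b : ℕ}
    (hF : F.IsHomogeneous b) {v : Fin n → k'} (hv : v ∈ ridge k' (Ideal.span {F})) :
    ∀ j : ℕ, 1 ≤ j → hasseD v j (MvPolynomial.map (algebraMap K k') F) = 0 := by
  intro j hj
  set F' := MvPolynomial.map (algebraMap K k') F with hF'
  rcases Nat.lt_or_ge b j with hlt | hle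
  · exact hasseD_eq_zero_of_totalDegree_lt v F' ((hF.map _).totalDegree_le.trans_lt hlt)
  · -- the `k'[T]`-point `T · (v ⊗ 1)` of the ridge
    have hw : (fun j => Polynomial.C (v j)) ∈ ridge (Polynomial k') (Ideal.span {F}) :=
      map_mem_ridge (IsScalarTower.toAlgHom K k' (Polynomial k')) hv
    have hXw := smul_mem_ridge' (TameRidge.homogeneousComponent_mem_span_singleton hF) (Polynomial.X : Polynomial k') hw
    have hmem := (TameRidge.mem_ridge_span_singleton_iff F _).mp hXw
    obtain ⟨g, hg⟩ := Ideal.mem_span_singleton'.mp hmem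
    -- transport to `k'[X][T]`
    have hΨ := congrArg ((optionEquivRight k' (Fin n)).symm.trans (optionEquivLeft k' (Fin n))) hg
    rw [map_mul, optionEquiv_map, optionEquiv_shift_map] at hΨ
    -- compare `T^j`-coefficients: `D_v^{(j)} F'` is a multiple of `F'`
    have hcoeff := congrArg (fun q => Polynomial.coeff q j) hΨ
    simp only [Polynomial.coeff_mul_C] at hcoeff
    rw [← hasseD_def] at hcoeff
    have hmemj : hasseD v j F' ∈ Ideal.span ({F'} : Set (MvPolynomial (Fin n) k')) :=
      Ideal.mem_span_singleton'.mpr ⟨_, hcoeff⟩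
    exact eq_zero_of_isHomogeneous_of_mem_span_singleton (hF.map _) (isHomogeneous_hasseD (hF.map _) v j)
      (by omega) hmemj

/-- [OURS · L1 W4.6 (iv); NOT a statement of the manuscript] **All Hasse derivatives vanish ⟹ ridge** (every
commutative `K`-algebra, every characteristic): if `D_v^{(j)}(F ⊗ 1) = 0` for all `j ≥ 1` then `F(X + v) = F(X)`, so
`v ∈ F(k')`. [folklore] -/
theorem mem_ridge_of_forall_hasseD {k' : Type v} [CommRing k'] [Algebra K k'] (F : MvPolynomial (Fin n) K)
    {v : Fin n → k'} (h : ∀ j : ℕ, 1 ≤ j → hasseD v j (MvPolynomial.map (algebraMap K k') F) = 0) :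
    v ∈ ridge k' (Ideal.span {F}) := by
  refine TameRidge.mem_ridge_of_shift_map_eq_self F ?_
  have hC := (TameRidge.dirShift_eq_C_iff v _).mpr h
  have h1 := TameRidge.eval_C_dirShift v (1 : k') (MvPolynomial.map (algebraMap K k') F)
  rw [hC, Polynomial.eval_C, one_smul] at h1
  exact h1.symm

/-- [OURS · L1 W4.6 (iv); NOT a statement of the manuscript] **THE RIDGE OF A FORM IS ITS HASSE STABILISER.** For a
form `F` of degree `b` over `K` and every commutative `K`-algebra `k'` (universe of `K`): `v ∈ F(k')` iff every
positive-order directional Hasse derivative of `F ⊗ 1` along `v` vanishes, i.e. iff `F(X + Tv) = F(X)` formally in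
`T` — in EVERY characteristic. [folklore] -/
theorem mem_ridge_span_singleton_iff_forall_hasseD {k' : Type u} [CommRing k'] [Algebra K k']
    {F : MvPolynomial (Fin n) K} {b : ℕ} (hF : F.IsHomogeneous b) (v : Fin n → k') :
    v ∈ ridge k' (Ideal.span {F}) ↔ ∀ j : ℕ, 1 ≤ j → hasseD v j (MvPolynomial.map (algebraMap K k') F) = 0 :=
  ⟨hasseD_eq_zero_of_mem_ridge hF, mem_ridge_of_forall_hasseD F⟩

/-- [OURS · L1 W4.6 (iv)] Equivalently: `v ∈ F(k')` iff `F(X + Tv) = F(X) ⊗ 1` in `k'[X][T]`. [folklore] -/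
theorem mem_ridge_span_singleton_iff_dirShift_eq {k' : Type u} [CommRing k'] [Algebra K k']
    {F : MvPolynomial (Fin n) K} {b : ℕ} (hF : F.IsHomogeneous b) (v : Fin n → k') :
    v ∈ ridge k' (Ideal.span {F}) ↔
      dirShift v (MvPolynomial.map (algebraMap K k') F) = Polynomial.C (MvPolynomial.map (algebraMap K k') F) := by
  rw [mem_ridge_span_singleton_iff_forall_hasseD hF, TameRidge.dirShift_eq_C_iff]

/-! ### Tame degree: the ridge is the polar kernel on every commutative `K`-algebra -/

/-- Transport of «`1, …, N` non-zero in `K`» to units of a `K`-algebra. [folklore] -/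
theorem isUnit_natCast_of_algebra {k' : Type v} [CommRing k'] [Algebra K k'] {N : ℕ}
    (hchar : ∀ m : ℕ, 1 ≤ m → m ≤ N → (m : K) ≠ 0) : ∀ m : ℕ, 1 ≤ m → m ≤ N → IsUnit (m : k') := by
  intro m h1 hm
  rw [← map_natCast (algebraMap K k')]
  exact ((hchar m h1 hm).isUnit).map _

/-- [OURS · L1 W4.6 (iv); NOT a statement of the manuscript] **TAME RIDGE = POLAR KERNEL AS FUNCTORS OF POINTS.**
For a form `F` of degree `b` over `K` with `1, …, b` non-zero in `K` (characteristic `0`, or `p > b`) and EVERY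
commutative `K`-algebra `k'` (universe of `K`): `v ∈ F(k') ⟺ Σ_i v_i (∂F/∂Y_i ⊗ 1) = 0` in `k'[X]`. The ridge of
a tame hypersurface cone is the `K`-linear subspace scheme `ker(polar)` (= Hironaka's `𝕎({F}) ⊗ k'`, `TamePolar`):
no group-scheme structure beyond a vector subspace survives in regime (iv). [folklore] -/
theorem mem_ridge_span_singleton_iff_polar_eq_zero {k' : Type u} [CommRing k'] [Algebra K k']
    {F : MvPolynomial (Fin n) K} {b : ℕ} (hF : F.IsHomogeneous b)
    (hchar : ∀ m : ℕ, 1 ≤ m → m ≤ b → (m : K) ≠ 0) (v : Fin n → k') :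
    v ∈ ridge k' (Ideal.span {F}) ↔ ∑ i, C (v i) * pderiv i (MvPolynomial.map (algebraMap K k') F) = 0 := by
  rw [mem_ridge_span_singleton_iff_forall_hasseD hF, TameRidge.polar_eq_hasseD_one]
  constructor
  · intro h
    exact h 1 le_rfl
  · intro h
    refine hasseD_eq_zero_of_polar_eq_zero_of_isUnit v (fun m h1 hm => ?_) ?_
    · exact isUnit_natCast_of_algebra hchar m h1 (hm.trans (hF.map _).totalDegree_le)
    · rwa [TameRidge.polar_eq_hasseD_one]

/-- [OURS · L1 W4.6 (iv)] **Characteristic `p > b`** version on every commutative `K`-algebra. [folklore] -/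
theorem mem_ridge_span_singleton_iff_polar_eq_zero_of_lt_char (p : ℕ) [CharP K p] {k' : Type u} [CommRing k']
    [Algebra K k'] {F : MvPolynomial (Fin n) K} {b : ℕ} (hF : F.IsHomogeneous b) (hb : b < p) (v : Fin n → k') :
    v ∈ ridge k' (Ideal.span {F}) ↔ ∑ i, C (v i) * pderiv i (MvPolynomial.map (algebraMap K k') F) = 0 :=
  mem_ridge_span_singleton_iff_polar_eq_zero hF (TamePolar.natCast_ne_zero_of_lt_char p hb) v

/-- [OURS · L1 W4.6 (iv)] In tame degree the ridge functor is `K`-LINEAR in the point: closed under addition of points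
and under all scalars, with the same `K`-linear equations over every `k'` — the functor of points of the vector subspace
`𝕎({F})`; in particular `v + w ∈ F(k')` for `v, w ∈ F(k')` follows from linearity of the polar in `v`. [folklore] -/
theorem polar_add {k' : Type v} [CommRing k'] (v w : Fin n → k') (G : MvPolynomial (Fin n) k') :
    ∑ i, C ((v + w) i) * pderiv i G = (∑ i, C (v i) * pderiv i G) + ∑ i, C (w i) * pderiv i G := by
  rw [← Finset.sum_add_distrib]
  exact Finset.sum_congr rfl fun i _ => by rw [Pi.add_apply, map_add, add_mul]

end Ridge

/-! ## The wild contrast at `b = p`: nilpotent points of the ridge of `Y_0^p` -/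

section Wild

variable (K : Type u) [Field K] {d : ℕ}

/-- **At degree `p` the ridge is a genuine group scheme**: in characteristic `p`, for ANY commutative `K`-algebra `k'`
and any `a ∈ k'` with `a^p = 0` (e.g. `a = ε` in `K[ε]/(ε^p)`), the point `a · e_0` lies in the ridge of `Y_0^p`
(`(Y_0 + a)^p = Y_0^p`), although for `a ≠ 0` it is not in the polar-kernel-free part… — precisely: the ridge of `Y_0^p`
has non-reduced structure (`μ_p`-like in the `Y_0`-direction), which the tame theorem
`mem_ridge_span_singleton_iff_polar_eq_zero` excludes for `deg F < p`. [folklore] -/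
theorem mem_ridge_X_pow_char_of_pow_eq_zero (p : ℕ) [Fact p.Prime] {k' : Type v} [CommRing k'] [Algebra K k']
    [CharP k' p] {a : k'} (ha : a ^ p = 0) :
    (Pi.single 0 a : Fin (d + 1) → k') ∈ ridge k' (Ideal.span {((X 0 : MvPolynomial (Fin (d + 1)) K) ^ p)}) := by
  refine TameRidge.mem_ridge_of_shift_map_eq_self _ ?_
  rw [map_pow, map_X, map_pow, shift_X, add_pow_char, ← map_pow C, Pi.single_eq_same, ha, map_zero, add_zero]

end Wild

end TameRidgeFunctor
end CampaignW46
end Summit.ResolutionOfSingularities.ResolutionOfSingularities.Theorems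

end
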